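import Literature.IUT.HodgeTheaters.PiAvatarLabelAffine
import Literature.IUT.HodgeTheaters.PiAvatarLocalObjectsGlue
import Literature.IUT.HodgeTheaters.KitCoreLabCusp
import HarnessLib

/-!
# The `𝒟^⊚`-side LABEL data at the genuine initial Θ-data: cusps of `C̲_K`, the label classes `LabCusp(𝒟^⊚)` and the action of
# `Aut(𝒟^⊚) = N(Π_{C̲_K})/Π_{C̲_K}` on them through `𝔽_l^⋇` ([IUTchI] Def 4.1 (v), Ex 4.3 (i); KIT-INSTANCE-SPEC / NFKIT-INSTANCE-MAP
# row NFK-3 — post-freeze additive D13, not a cone member; 2 small defs + proofs)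

S. Mochizuki, *Inter-universal Teichmüller theory I*, kurims manuscript (May 2020), Def 4.1 (ii) p. 96 l. 10–20 («a label class of
cusps of `†𝒟_v` [is] the set of cusps of `†𝒟_v` that lie over a single nonzero cusp of `†𝒟̲_v`»; «`LabCusp(†𝒟_v)` admits a natural
`𝔽_l^⋇`-torsor structure [which arises from the natural action of `𝔽_l^×` on the quotient `Q`]»), Def 4.1 (v) p. 97 l. 33–37 («it
makes sense to speak of the set of cusps of `†𝒟^⊚`, as well as the set of label classes of cusps `LabCusp(†𝒟^⊚)` of `†𝒟^⊚`, which
admits a natural `𝔽_l^⋇`-torsor structure»), Ex 4.3 (i) pp. 98–99 («`Aut_ε̲(C̲_K) ⊆ Aut(C̲_K) ≅ Aut(𝒟^⊚)`», the «semi-unipotent, up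
to `±1`» and «Borel» subgroups, «natural isomorphisms … `Aut(C̲_K)/Aut_ε̲(C̲_K) ⥲ 𝔽_l^⋇`») ([IUTchI] Def 4.1 (v) p.97)
[claim: Mochizuki2012, status: disputed] (D-0012 claim key, series status DISPUTED — definitions + kernel theorems over abc-iut-L5-t2's
REAL `InitialThetaData`, abc-iut-L5-t1's `CuspGalois`, under abc-iut-L5-t4's hypothesis binder `hS : D.CuspClassesNormaliserStable`
(G-L5t4g3-3); nothing of the series is asserted, no side is taken on [IUTchIII] Cor. 3.12).

READING (design D1 EMBEDDED; single writer of the NF-side kit = abc-iut-L5-t3, L5-lead RULINGS #31 (1) / #43 (2) GO (a)).  In the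
Π-avatar `𝒟^⊚ = ℬ(Π_{C̲_K})⁰` and `𝒟^{⊚±} = ℬ(Π_{X̲_K})⁰ → 𝒟^⊚` is the double covering with deck group `Π_{C̲_K}/Π_{X̲_K} = {1, ι̲}`.  The
cusps of `C̲_K` are the `ι̲`-orbits of the cusps of `X̲_K`; since `ι̲` reads `z ↦ −z` in the chart based at `ε⁰` ((K2),
`PiAvatarGlobalCuspLabels`), these orbits ARE the `±`-classes `|Cusp(X̲_K)|` of abc-iut-L5-t4's `𝔽_l^±`-group `gLabPMModel CG`, the zero
cusp of `C̲_K` is the class of `ε⁰`, and **`LabCusp(𝒟^⊚)` = the nonzero classes = `(D.gLabPMModel CG).AbsStar`**, labelled by `𝔽_l^⋇`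
through abc-iut-L5-t3's `FlPMGroup.absStarEquiv` (KitCoreLabCusp) — the natural `𝔽_l^⋇`-torsor structure «from the action of `𝔽_l^×`
on `Q`».  Automorphisms: `Aut(𝒟^⊚) = N(Π_{C̲_K})/Π_{C̲_K}` (t4 `OrbitCat.autEquiv`) and **`N(Π_{C̲_K}) ≤ N(Π_{X̲_K})`**
(`normalizer_PiCund_le_normalizer_PiXund`: `Π_{X̲_K} = Π_{X_F} ∩ Π_{C̲_K}` with `Π_{X_F} ⊴ Π_{C_F}`), so `Aut(𝒟^⊚)` acts on `Cusp(X̲_K)` by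
t4's derived action `actF`; an `n ∈ N(Π_{C̲_K})` commutes with `ι̲` up to `Π_{X̲_K}`, hence (affineness, `PiAvatarLabelAffine`) FIXES
`ε⁰` and acts LINEARLY `z ↦ actFSlope(n)·z` in the chart; it therefore permutes the `±`-classes, and on `LabCusp(𝒟^⊚)` multiplies the
label by the class of its slope in `𝔽_l^⋇` — print's `Aut(C̲_K)/Aut_ε̲(C̲_K) ⥲ 𝔽_l^⋇`.  Surjectivity of that character (the NF-kit
field `exists_aut_smul`) is NOT claimed here (instance law G-w4d065g3-1 / t8's torsion monodromy).

CONTENTS: `normalizer_PiCund_le_normalizer_PiXund`, `nfNormalizerIncl` (def), `conj_mem_PiCund_not_mem_PiXund`; for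
`n ∈ N(Π_{C̲_K})`: `actF_nf_ε0` (fixes `ε⁰`), `gChart₀Model_actF_nf` (linear), `actF_nf_neg` (commutes with `−`), `toAbs_actF_nf_*`;
`labActNF` (def: the permutation of `LabCusp(𝒟^⊚)`), `labActNF_one/_mul`, **`absStarLabel_labActNF`** (labels multiply by
`FlStar.mk (actFSlopeUnit n)`), `labActNF_eq_self_of_mem_PiCund` (`Π_{C̲_K}` acts trivially — the action descends to
`Aut(𝒟^⊚)`).  The packaging as `Aut(𝒟^⊚) →* Perm`/`→* 𝔽_l^⋇` is the sequel.  No instance/notation; typed ≠ proved elsewhere.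
-/

noncomputable section

namespace Literature.IUT.HodgeTheaters

open scoped Pointwise

universe u v w

section NFCuspLabels

variable {F : Type u} {K : Type v} {Fbar : Type w} [Field F] [NumberField F] [Field K] [NumberField K]
  [Algebra F K] [Field Fbar] [Algebra F Fbar] [Algebra K Fbar]
  {E : WeierstrassCurve F} [E.IsElliptic] {l : ℕ} {Pb : BadPlacePredicates K}
  (D : InitialThetaData F K Fbar E l Pb) (CG : D.geom.pe.CuspGalois) (hS : D.CuspClassesNormaliserStable)

namespace InitialThetaData

/-! ### `N(Π_{C̲_K}) ≤ N(Π_{X̲_K})`: every automorphism of `𝒟^⊚` acts on the cusps of `X̲_K` -/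

/-- **`N_{Π_{C_F}}(Π_{C̲_K}) ≤ N_{Π_{C_F}}(Π_{X̲_K})`**: `Π_{X̲_K} = Π_{X_F} ∩ Π_{C̲_K}` (t4's `PiXund_eq_PiX_inf_PiCund`) with `Π_{X_F} ⊴ Π_{C_F}`
(Def 3.1 (b)), so an element normalising `Π_{C̲_K}` normalises `Π_{X̲_K}` — print: `X̲_K` is DETERMINED by `C̲_K` ([EtTh] Def 2.1,
Def 3.1 (d) «`C̲_K` … determines a hyperbolic orbicurve `X̲_K`»), so `Aut(𝒟^⊚) = Aut(C̲_K)` acts on `X̲_K` and its cusps.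
([IUTchI] Def 3.1 (d) p.62) [claim: Mochizuki2012, status: disputed] -/
theorem normalizer_PiCund_le_normalizer_PiXund :
    Subgroup.normalizer ((D.PiCund : Subgroup D.PiC) : Set D.PiC) ≤
      Subgroup.normalizer ((D.PiXund : Subgroup D.PiC) : Set D.PiC) := by
  intro n hn
  have hXF : n ∈ Subgroup.normalizer ((D.geom.PiX : Subgroup D.PiC) : Set D.PiC) := by
    haveI := D.geom.PiX_normal
    rw [Subgroup.normalizer_eq_top]
    exact Subgroup.mem_top n
  rw [Subgroup.mem_normalizer_iff] at hn hXF ⊢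
  intro x
  rw [D.PiXund_eq_PiX_inf_PiCund, Subgroup.mem_inf, Subgroup.mem_inf, hXF x, hn x]

/-- The inclusion `N(Π_{C̲_K}) ↪ N(Π_{X̲_K})` (through which `Aut(𝒟^⊚)`-representatives act on `Cusp(X̲_K)` by t4's `actF`).
([IUTchI] Def 4.1 (v) p.97) [claim: Mochizuki2012, status: disputed] -/
def nfNormalizerIncl :
    ↥(Subgroup.normalizer ((D.PiCund : Subgroup D.PiC) : Set D.PiC)) →*
      ↥(Subgroup.normalizer ((D.PiXund : Subgroup D.PiC) : Set D.PiC)) :=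
  Subgroup.inclusion D.normalizer_PiCund_le_normalizer_PiXund

/-- The inclusion is the identity on underlying elements. ([IUTchI] Def 4.1 (v) p.97) [claim: Mochizuki2012, status: disputed] -/
@[simp] theorem coe_nfNormalizerIncl (n : ↥(Subgroup.normalizer ((D.PiCund : Subgroup D.PiC) : Set D.PiC))) :
    ((D.nfNormalizerIncl n : ↥(Subgroup.normalizer ((D.PiXund : Subgroup D.PiC) : Set D.PiC))) : D.PiC) = (n : D.PiC) := rfl

/-- `Π_{C̲_K} ≤ N(Π_{C̲_K})`. ([IUTchI] Def 4.1 (v) p.97) [claim: Mochizuki2012, status: disputed] -/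
theorem PiCund_le_normalizer_PiCund : D.PiCund ≤ Subgroup.normalizer ((D.PiCund : Subgroup D.PiC) : Set D.PiC) :=
  Subgroup.le_normalizer

/-- Conjugating an element of `Π_{C̲_K} ∖ Π_{X̲_K}` (a representative of `ι̲`) by `n ∈ N(Π_{C̲_K})` gives again an element of
`Π_{C̲_K} ∖ Π_{X̲_K}`: automorphisms of `𝒟^⊚` commute with the deck involution of `𝒟^{⊚±} → 𝒟^⊚` up to `Π_{X̲_K}`.
([IUTchI] Def 6.1 (v) p.158) [claim: Mochizuki2012, status: disputed] -/
theorem conj_mem_PiCund_not_mem_PiXund (n : ↥(Subgroup.normalizer ((D.PiCund : Subgroup D.PiC) : Set D.PiC)))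
    {c : D.PiC} (hc : c ∈ D.PiCund) (hcX : c ∉ D.PiXund) :
    (n : D.PiC) * c * (n : D.PiC)⁻¹ ∈ D.PiCund ∧ (n : D.PiC) * c * (n : D.PiC)⁻¹ ∉ D.PiXund := by
  refine ⟨(Subgroup.mem_normalizer_iff.mp n.2 c).mp hc, fun h => hcX ?_⟩
  exact (Subgroup.mem_normalizer_iff.mp (D.normalizer_PiCund_le_normalizer_PiXund n.2) c).mpr h

variable [Fact l.Prime]

/-! ### Elements of `Π_{C̲_K} ∖ Π_{X̲_K}` read `z ↦ −z`; elements of `Π_{C̲_K}` fix `ε⁰` -/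

/-- An element of `Π_{C̲_K} ∖ Π_{X̲_K}` acts on `Cusp(X̲_K)` by `z ↦ −z` in the chart based at `ε⁰` (t4's (K2), through `actF`).
([IUTchI] Def 6.1 (v) p.158) [claim: Mochizuki2012, status: disputed] -/
theorem gChart₀Model_actF_of_not_mem_PiXund {c : D.PiC} (hc : c ∈ D.PiCund) (hcX : c ∉ D.PiXund)
    (hn : c ∈ Subgroup.normalizer ((D.PiXund : Subgroup D.PiC) : Set D.PiC)) (x : D.geom.pe.Cusp) :
    D.gChart₀Model CG (D.actF CG hS ⟨c, hn⟩ x) = - D.gChart₀Model CG x := by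
  obtain ⟨c', hc', hcc⟩ := Subgroup.mem_map.mp hc
  have hc'X : c' ∉ D.geom.pe.PiX := fun h => hcX (by
    rw [← hcc]; exact Subgroup.mem_map_of_mem _ (Subgroup.mem_inf.mpr ⟨h, hc'⟩))
  have hn' : D.geom.embK c' ∈ Subgroup.normalizer ((D.PiXund : Subgroup D.PiC) : Set D.PiC) := by rw [hcc]; exact hn
  have heq : (⟨c, hn⟩ : ↥(Subgroup.normalizer ((D.PiXund : Subgroup D.PiC) : Set D.PiC))) = ⟨D.geom.embK c', hn'⟩ :=
    Subtype.ext hcc.symm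
  rw [heq]
  exact D.gChart₀Model_actF_embK_of_not_mem_PiX CG hS hc' hc'X hn' x

omit [Fact l.Prime] in
/-- Every element of `Π_{C̲_K}` fixes `ε⁰` (t1's `act_ε0`, through `actF`). ([IUTchI] §1 p.37) [claim: Mochizuki2012, status: disputed] -/
theorem actF_ε0_of_mem_PiCund {c : D.PiC} (hc : c ∈ D.PiCund)
    (hn : c ∈ Subgroup.normalizer ((D.PiXund : Subgroup D.PiC) : Set D.PiC)) :
    D.actF CG hS ⟨c, hn⟩ D.geom.pe.ε0 = D.geom.pe.ε0 := by
  obtain ⟨c', hc', hcc⟩ := Subgroup.mem_map.mp hc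
  have hn' : D.geom.embK c' ∈ Subgroup.normalizer ((D.PiXund : Subgroup D.PiC) : Set D.PiC) := by rw [hcc]; exact hn
  have heq : (⟨c, hn⟩ : ↥(Subgroup.normalizer ((D.PiXund : Subgroup D.PiC) : Set D.PiC))) = ⟨D.geom.embK c', hn'⟩ :=
    Subtype.ext hcc.symm
  rw [heq]
  exact D.actF_embK_ε0_of_mem_PiCbar CG hS hc' hn'

/-! ### Automorphisms of `𝒟^⊚` fix the zero cusp and act linearly -/

/-- **`Aut(𝒟^⊚)` fixes the zero cusp**: for `n ∈ N(Π_{C̲_K})`, `actF n ε⁰ = ε⁰` — conjugating a representative `c` of `ι̲` by `n`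
gives another representative, both read `z ↦ −z`, so the translation part `t` of the affine map `actF n` satisfies `t = −t`, i.e.
`t = 0` (`l` odd).  Print: `ε⁰` is «the unique zero cusp» and `Aut(C̲_K)` permutes the NONZERO cusps (Ex 4.3 (i)).
([IUTchI] Ex 4.3 (i) p.98) [claim: Mochizuki2012, status: disputed] -/
theorem actF_nf_ε0 (n : ↥(Subgroup.normalizer ((D.PiCund : Subgroup D.PiC) : Set D.PiC))) :
    D.actF CG hS (D.nfNormalizerIncl n) D.geom.pe.ε0 = D.geom.pe.ε0 := by
  -- a representative `c` of the deck involution and its `n`-conjugate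
  obtain ⟨c, hnc, hc, hcX, -, -⟩ := D.exists_globalInvolution
  obtain ⟨hc2, hc2X⟩ := D.conj_mem_PiCund_not_mem_PiXund n hc hcX
  have hnc2 : (n : D.PiC) * c * (n : D.PiC)⁻¹ ∈ Subgroup.normalizer ((D.PiXund : Subgroup D.PiC) : Set D.PiC) :=
    D.piCund_le_normalizer_piXund hc2
  set m := D.nfNormalizerIncl n with hm
  set t : ZMod l := D.gChart₀Model CG (D.actF CG hS m D.geom.pe.ε0) with ht
  -- `m * c = (n c n⁻¹) * m` in `N(Π_{X̲_K})`
  have hprod : m * ⟨c, hnc⟩ = ⟨(n : D.PiC) * c * (n : D.PiC)⁻¹, hnc2⟩ * m := by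
    apply Subtype.ext
    change (n : D.PiC) * c = (n : D.PiC) * c * (n : D.PiC)⁻¹ * (n : D.PiC)
    rw [inv_mul_cancel_right]
  have key : t = -t := by
    have h1 : D.gChart₀Model CG (D.actF CG hS (m * ⟨c, hnc⟩) D.geom.pe.ε0) = t := by
      rw [map_mul, Equiv.Perm.mul_apply, D.actF_ε0_of_mem_PiCund CG hS hc hnc]
    have h2 : D.gChart₀Model CG (D.actF CG hS (⟨(n : D.PiC) * c * (n : D.PiC)⁻¹, hnc2⟩ * m) D.geom.pe.ε0) = -t := by
      rw [map_mul, Equiv.Perm.mul_apply, D.gChart₀Model_actF_of_not_mem_PiXund CG hS hc2 hc2X hnc2]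
    calc t = D.gChart₀Model CG (D.actF CG hS (m * ⟨c, hnc⟩) D.geom.pe.ε0) := h1.symm
      _ = D.gChart₀Model CG (D.actF CG hS (⟨(n : D.PiC) * c * (n : D.PiC)⁻¹, hnc2⟩ * m) D.geom.pe.ε0) := by rw [hprod]
      _ = -t := h2
  -- `t = -t` forces `t = 0` since `l` is an odd prime
  have hl2 : l ≠ 2 := by have := D.five_le_l; omega
  have ht0 : t = 0 := by
    rcases (ZMod.neg_eq_self_iff t).mp key.symm with h | h
    · exact h
    · exfalso
      have hodd : Odd l := (Fact.out : l.Prime).odd_of_ne_two hl2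
      exact (Nat.not_even_iff_odd.mpr hodd) ⟨t.val, by omega⟩
  apply (D.gChart₀Model CG).injective
  rw [D.gChart₀Model_ε0 CG]
  exact ht0

/-- **`Aut(𝒟^⊚)` acts LINEARLY on the cusps**: for `n ∈ N(Π_{C̲_K})`, `gChart₀ (actF n x) = actFSlope n * gChart₀ x` (affineness
with vanishing translation part) — the Borel element has the shape `(u ∗; 0 ±…)` with no translation, cf. Ex 4.3 (i).
([IUTchI] Ex 4.3 (i) p.99) [claim: Mochizuki2012, status: disputed] -/
theorem gChart₀Model_actF_nf (n : ↥(Subgroup.normalizer ((D.PiCund : Subgroup D.PiC) : Set D.PiC))) (x : D.geom.pe.Cusp) :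
    D.gChart₀Model CG (D.actF CG hS (D.nfNormalizerIncl n) x) =
      D.actFSlope CG hS (D.nfNormalizerIncl n) * D.gChart₀Model CG x := by
  rw [D.gChart₀Model_actF CG hS, D.actF_nf_ε0 CG hS n, D.gChart₀Model_ε0 CG, add_zero]

/-- The zero of t4's `𝔽_l^±`-group of cusps is `ε⁰` (its chart `gChart₀` is based at `ε⁰`, (K1)).
([IUTchI] Def 6.1 (iii) p.156) [claim: Mochizuki2012, status: disputed] -/
theorem gLabPMModel_zero : (D.gLabPMModel CG).zero = D.geom.pe.ε0 := by
  apply (D.gChart₀Model CG).injective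
  rw [(D.gLabPMModel CG).chart_zero (D.gChart₀Model_mem_gLabPMModel_charts CG), D.gChart₀Model_ε0 CG]

/-- **`Aut(𝒟^⊚)` commutes with `−1` on the cusps**: `actF n (−x) = −(actF n x)` for `n ∈ N(Π_{C̲_K})` (linearity).
([IUTchI] Ex 4.3 (i) p.99) [claim: Mochizuki2012, status: disputed] -/
theorem actF_nf_neg (n : ↥(Subgroup.normalizer ((D.PiCund : Subgroup D.PiC) : Set D.PiC))) (x : D.geom.pe.Cusp) :
    D.actF CG hS (D.nfNormalizerIncl n) ((D.gLabPMModel CG).neg x) = (D.gLabPMModel CG).neg (D.actF CG hS (D.nfNormalizerIncl n) x) := by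
  apply (D.gChart₀Model CG).injective
  rw [D.gChart₀Model_actF_nf CG hS, (D.gLabPMModel CG).chart_neg (D.gChart₀Model_mem_gLabPMModel_charts CG),
    (D.gLabPMModel CG).chart_neg (D.gChart₀Model_mem_gLabPMModel_charts CG), D.gChart₀Model_actF_nf CG hS, mul_neg]

/-! ### The cusps of `C̲_K` = `±`-classes of cusps of `X̲_K`; `Aut(𝒟^⊚)` permutes them -/

/-- The map induced by `n ∈ N(Π_{C̲_K})` on the cusps of `C̲_K` = the `±`-classes `|Cusp(X̲_K)|` (well defined by `actF_nf_neg`).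
([IUTchI] Def 4.1 (v) p.97) [claim: Mochizuki2012, status: disputed] -/
theorem toAbs_actF_nf_wd (n : ↥(Subgroup.normalizer ((D.PiCund : Subgroup D.PiC) : Set D.PiC))) {x y : D.geom.pe.Cusp}
    (h : (D.gLabPMModel CG).toAbs x = (D.gLabPMModel CG).toAbs y) :
    (D.gLabPMModel CG).toAbs (D.actF CG hS (D.nfNormalizerIncl n) x) =
      (D.gLabPMModel CG).toAbs (D.actF CG hS (D.nfNormalizerIncl n) y) := by
  rw [(D.gLabPMModel CG).toAbs_eq_toAbs_iff] at h ⊢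
  rcases h with h | h
  · exact Or.inl (by rw [h])
  · exact Or.inr (by rw [h, D.actF_nf_neg CG hS])

/-- `Aut(𝒟^⊚)` preserves the zero cusp class of `C̲_K`. ([IUTchI] Def 4.1 (v) p.97) [claim: Mochizuki2012, status: disputed] -/
theorem toAbs_actF_nf_zero (n : ↥(Subgroup.normalizer ((D.PiCund : Subgroup D.PiC) : Set D.PiC))) :
    (D.gLabPMModel CG).toAbs (D.actF CG hS (D.nfNormalizerIncl n) (D.gLabPMModel CG).zero) =
      (D.gLabPMModel CG).toAbs (D.gLabPMModel CG).zero := by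
  rw [D.gLabPMModel_zero CG, D.actF_nf_ε0 CG hS n]

/-- `Aut(𝒟^⊚)` preserves NONZERO cusp classes (the slope is a unit). ([IUTchI] Def 4.1 (v) p.97) [claim: Mochizuki2012, status: disputed] -/
theorem toAbs_actF_nf_ne_zero (n : ↥(Subgroup.normalizer ((D.PiCund : Subgroup D.PiC) : Set D.PiC))) {x : D.geom.pe.Cusp}
    (hx : (D.gLabPMModel CG).toAbs x ≠ (D.gLabPMModel CG).toAbs (D.gLabPMModel CG).zero) :
    (D.gLabPMModel CG).toAbs (D.actF CG hS (D.nfNormalizerIncl n) x) ≠ (D.gLabPMModel CG).toAbs (D.gLabPMModel CG).zero := by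
  intro h
  apply hx
  rw [(D.gLabPMModel CG).toAbs_eq_toAbs_zero_iff,
    ← (D.gLabPMModel CG).chart_eq_zero_iff (D.gChart₀Model_mem_gLabPMModel_charts CG)] at h ⊢
  rw [D.gChart₀Model_actF_nf CG hS] at h
  rcases mul_eq_zero.mp h with h0 | h0
  · exact absurd h0 (D.actFSlope_ne_zero CG hS _)
  · exact h0

/-- **The action of `n ∈ N(Π_{C̲_K})` (a representative of an automorphism of `𝒟^⊚`) on `LabCusp(𝒟^⊚)`** = the nonzero
`±`-classes of cusps of `X̲_K` = the nonzero cusps of `C̲_K`. ([IUTchI] Def 4.1 (v) p.97) [claim: Mochizuki2012, status: disputed] -/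
def labActNF (n : ↥(Subgroup.normalizer ((D.PiCund : Subgroup D.PiC) : Set D.PiC))) :
    (D.gLabPMModel CG).AbsStar → (D.gLabPMModel CG).AbsStar := fun q =>
  ⟨Quotient.hrecOn (motive := fun _ => (D.gLabPMModel CG).Abs) q.1
      (fun x => (D.gLabPMModel CG).toAbs (D.actF CG hS (D.nfNormalizerIncl n) x))
      (fun x y hxy => heq_of_eq (D.toAbs_actF_nf_wd CG hS n (Quotient.sound hxy))),
    by
      obtain ⟨q, hq⟩ := q
      induction q using Quotient.inductionOn with
      | h x => exact D.toAbs_actF_nf_ne_zero CG hS n hq⟩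

/-- `labActNF` on the class of a cusp `x` is the class of `n·x`. ([IUTchI] Def 4.1 (v) p.97) [claim: Mochizuki2012, status: disputed] -/
theorem labActNF_mk (n : ↥(Subgroup.normalizer ((D.PiCund : Subgroup D.PiC) : Set D.PiC))) (x : D.geom.pe.Cusp)
    (hx : (D.gLabPMModel CG).toAbs x ≠ (D.gLabPMModel CG).toAbs (D.gLabPMModel CG).zero) :
    D.labActNF CG hS n ⟨(D.gLabPMModel CG).toAbs x, hx⟩ =
      ⟨(D.gLabPMModel CG).toAbs (D.actF CG hS (D.nfNormalizerIncl n) x), D.toAbs_actF_nf_ne_zero CG hS n hx⟩ := rfl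

/-- `labActNF 1 = id`. ([IUTchI] Def 4.1 (v) p.97) [claim: Mochizuki2012, status: disputed] -/
theorem labActNF_one (q : (D.gLabPMModel CG).AbsStar) : D.labActNF CG hS 1 q = q := by
  obtain ⟨q, hq⟩ := q
  obtain ⟨x, rfl⟩ := (D.gLabPMModel CG).toAbs_surjective q
  rw [D.labActNF_mk CG hS]
  apply Subtype.ext
  change (D.gLabPMModel CG).toAbs (D.actF CG hS (D.nfNormalizerIncl 1) x) = (D.gLabPMModel CG).toAbs x
  rw [map_one, map_one, Equiv.Perm.one_apply]

/-- `labActNF (n m) = labActNF n ∘ labActNF m`. ([IUTchI] Def 4.1 (v) p.97) [claim: Mochizuki2012, status: disputed] -/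
theorem labActNF_mul (n m : ↥(Subgroup.normalizer ((D.PiCund : Subgroup D.PiC) : Set D.PiC))) (q : (D.gLabPMModel CG).AbsStar) :
    D.labActNF CG hS (n * m) q = D.labActNF CG hS n (D.labActNF CG hS m q) := by
  obtain ⟨q, hq⟩ := q
  obtain ⟨x, rfl⟩ := (D.gLabPMModel CG).toAbs_surjective q
  rw [D.labActNF_mk CG hS, D.labActNF_mk CG hS, D.labActNF_mk CG hS]
  apply Subtype.ext
  change (D.gLabPMModel CG).toAbs (D.actF CG hS (D.nfNormalizerIncl (n * m)) x) =
    (D.gLabPMModel CG).toAbs (D.actF CG hS (D.nfNormalizerIncl n) (D.actF CG hS (D.nfNormalizerIncl m) x))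
  rw [map_mul, map_mul, Equiv.Perm.mul_apply]

/-- **`Aut(𝒟^⊚)` acts on `LabCusp(𝒟^⊚)` THROUGH `𝔽_l^⋇`**: the label of `n·q` is `[slope n] · label q` in `𝔽_l^⋇ = 𝔽_l^×/{±1}` —
the natural isomorphism `Aut(C̲_K)/Aut_ε̲(C̲_K) ⥲ 𝔽_l^⋇` of Ex 4.3 (i), read on the label classes of cusps.
([IUTchI] Ex 4.3 (i) p.99) [claim: Mochizuki2012, status: disputed] -/
theorem absStarLabel_labActNF (n : ↥(Subgroup.normalizer ((D.PiCund : Subgroup D.PiC) : Set D.PiC))) (q : (D.gLabPMModel CG).AbsStar) :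
    (D.gLabPMModel CG).absStarLabel (D.labActNF CG hS n q) =
      FlStar.mk l (D.actFSlopeUnit CG hS (D.nfNormalizerIncl n)) * (D.gLabPMModel CG).absStarLabel q := by
  obtain ⟨q, hq⟩ := q
  obtain ⟨x, rfl⟩ := (D.gLabPMModel CG).toAbs_surjective q
  have hmem := D.gChart₀Model_mem_gLabPMModel_charts CG
  have hx0 : D.gChart₀Model CG x ≠ 0 := fun h => hq (((D.gLabPMModel CG).toAbs_eq_toAbs_zero_iff x).mpr
    (((D.gLabPMModel CG).chart_eq_zero_iff hmem x).mp h))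
  have hnx0 : D.gChart₀Model CG (D.actF CG hS (D.nfNormalizerIncl n) x) ≠ 0 := by
    rw [D.gChart₀Model_actF_nf CG hS]
    exact mul_ne_zero (D.actFSlope_ne_zero CG hS _) hx0
  rw [D.labActNF_mk CG hS, (D.gLabPMModel CG).absStarLabel_mk, (D.gLabPMModel CG).absStarLabel_mk,
    (D.gLabPMModel CG).starLabelOf_eq_of_mem hmem _ _ hnx0, (D.gLabPMModel CG).starLabelOf_eq_of_mem hmem _ _ hx0]
  change (QuotientGroup.mk _ : FlStar l) = QuotientGroup.mk _ * QuotientGroup.mk _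
  rw [← QuotientGroup.mk_mul]
  congr 1
  apply Units.ext
  rw [Units.val_mk0, Units.val_mul, Units.val_mk0, val_actFSlopeUnit, D.gChart₀Model_actF_nf CG hS]

/-! ### `Π_{C̲_K}` acts trivially on `LabCusp(𝒟^⊚)`: the action descends to `Aut(𝒟^⊚) = N(Π_{C̲_K})/Π_{C̲_K}` -/

/-- An element of `Π_{C̲_K}` (i.e. `1` or `ι̲` modulo `Π_{X̲_K}`) maps every cusp of `X̲_K` to `±` itself.
([IUTchI] Def 6.1 (v) p.158) [claim: Mochizuki2012, status: disputed] -/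
theorem toAbs_actF_of_mem_PiCund {c : D.PiC} (hc : c ∈ D.PiCund)
    (hn : c ∈ Subgroup.normalizer ((D.PiXund : Subgroup D.PiC) : Set D.PiC)) (x : D.geom.pe.Cusp) :
    (D.gLabPMModel CG).toAbs (D.actF CG hS ⟨c, hn⟩ x) = (D.gLabPMModel CG).toAbs x := by
  rw [(D.gLabPMModel CG).toAbs_eq_toAbs_iff]
  by_cases hcX : c ∈ D.PiXund
  · left
    rw [D.actF_eq_one_of_mem_PiXund CG hS ⟨c, hn⟩ hcX, Equiv.Perm.one_apply]
  · right
    apply (D.gChart₀Model CG).injective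
    rw [(D.gLabPMModel CG).chart_neg (D.gChart₀Model_mem_gLabPMModel_charts CG),
      D.gChart₀Model_actF_of_not_mem_PiXund CG hS hc hcX hn, neg_neg]

/-- **`Π_{C̲_K}` acts trivially on `LabCusp(𝒟^⊚)`**, so `labActNF` is an action of `Aut(𝒟^⊚) = N(Π_{C̲_K})/Π_{C̲_K}`
(t4's `OrbitCat.autEquiv D.PiCund`). ([IUTchI] Def 4.1 (v) p.97) [claim: Mochizuki2012, status: disputed] -/
theorem labActNF_eq_self_of_mem_PiCund (n : ↥(Subgroup.normalizer ((D.PiCund : Subgroup D.PiC) : Set D.PiC)))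
    (hn : (n : D.PiC) ∈ D.PiCund) (q : (D.gLabPMModel CG).AbsStar) : D.labActNF CG hS n q = q := by
  obtain ⟨q, hq⟩ := q
  obtain ⟨x, rfl⟩ := (D.gLabPMModel CG).toAbs_surjective q
  rw [D.labActNF_mk CG hS]
  apply Subtype.ext
  exact D.toAbs_actF_of_mem_PiCund CG hS hn (D.normalizer_PiCund_le_normalizer_PiXund n.2) x

/-- The slope class in `𝔽_l^⋇` of an element of `Π_{C̲_K}` is trivial (slope `±1`). ([IUTchI] Def 6.1 (v) p.158) [claim: Mochizuki2012, status: disputed] -/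
theorem flStar_mk_actFSlopeUnit_eq_one_of_mem_PiCund (n : ↥(Subgroup.normalizer ((D.PiCund : Subgroup D.PiC) : Set D.PiC)))
    (hn : (n : D.PiC) ∈ D.PiCund) : FlStar.mk l (D.actFSlopeUnit CG hS (D.nfNormalizerIncl n)) = 1 := by
  rw [FlStar.mk_eq_one_iff]
  rcases D.actFSlope_eq_one_or_eq_neg_one_of_mem_PiCund CG hS (D.nfNormalizerIncl n) hn with h | h
  · exact Or.inl (Units.ext h)
  · exact Or.inr (Units.ext h)

end InitialThetaData

end NFCuspLabels

end Literature.IUT.HodgeTheaters
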